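import Literature.NumberTheory.Sieve.Maynard2016Lemma93PPrime
import Literature.NumberTheory.Sieve.Maynard2016Lemma93EmSummation
import HarnessLib

/-!
# Maynard 2016, proof of Lemma 9.3 — the modulus of the `e_m`-summation (displays (9.27)–(9.29))

Sources: J. Maynard, *Dense clusters of primes in subsets*, Compositio Math. 152 (2016) 1517–1554 =
arXiv:1405.2593 [Maynard2016DenseClusters], proof of Lemma 9.3, pp. 23–24 (displays (9.27)–(9.29): the sum
over `e_m` «square-free, (e_m, W B r a_m) = 1, (e_m, W_m) = 1», the Euler product «∏_{p ∤ W B r a_m W_m}»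
and `W_m/φ(W_m)`); K. Ford, B. Green, S. Konyagin, J. Maynard, T. Tao, *Long gaps between primes*, JAMS 31
(2018) [FordGreenKonyaginMaynardTao2018], §7 (7.8), Thm 6 (7.13).

This file joins the `FGKMT2018` side of the proof of Lemma 9.3 (`eulerProd_eq_prod_good_mul_prod_mstar`,
`eulerProd_update_div_phiOmega_eq`) to the `MaynardDense` side (`emEuler`, `emWeight`, `emSum`,
`emSummation` of `Maynard2016Lemma93EmSummation`) through ONE modulus:
* `mstarProd L B N m M = ∏ {p ∣ N prime : p ∤ WB·M·a_m, m ∉ admIdx(p)}` — Maynard's `W_m` (restricted to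
  `p ∣ N`, `N = ⌊R⌋#` in the application);
* `emModulus L B N m M = a_m · WB · M · mstarProd` — the modulus `W B r a_m W_m` of (9.29) (`M = ∏ r`).
Results: `emEuler (emModulus …(⌊R⌋#)…) ω (⌊R⌋+1) = ∏_{p ≤ ⌊R⌋, good} X_p` (`emEuler_emModulus_eq`), hence
**`P' = ∏_{p ≤ ⌊R⌋} Λ_p(M) = emEuler(emModulus) · W_m/φ(W_m)`** (`eulerProd_eq_emEuler_mul`, display (9.28));
and the range of `c = e_m`: **`r[m↦c] ∈ admBox ↔ c ∣ ⌊R⌋# ∧ (c, emModulus(∏ r)) = 1`**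
(`update_mem_admBox_iff`, `r ∈ 𝒟'^{(m)}_k`), with `(∏_{p∣c}(p − ω)X_p)⁻¹ = emWeight (emModulus) ω c` on that
range (`inv_prod_eq_emWeight`) — so the main term of `yVarM_eq_main_add_err` is
`(∏r/φ_L)·P'·∑_{c ∣ ⌊R⌋#} emWeight(c)·y_{r[m↦c]}`, the left side of (9.29).

## References
* J. Maynard, *Dense clusters of primes in subsets*, Compositio Math. 152 (2016), proof of Lemma 9.3
  pp. 23–24, (9.27)–(9.29) [Maynard2016DenseClusters].
* K. Ford, B. Green, S. Konyagin, J. Maynard, T. Tao, *Long gaps between primes*, JAMS 31 (2018), §7 (7.8),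
  Thm 6 (7.13) [FordGreenKonyaginMaynardTao2018].
-/

noncomputable section

open Finset
open scoped Nat

namespace Literature.NumberTheory.Sieve

namespace FGKMT2018

variable {k : ℕ}

/-- Maynard's `W_m` (restricted to the primes of `N`): the product of the primes `p ∣ N` with
`p ∤ WB`, `p ∤ M`, `p ∤ a_m` and `m ∉ admIdx(p)` (no `n` with `p ∣ L_m(n)` first among the forms).
[cite: Maynard2016DenseClusters, proof of Lemma 9.3 p. 24, (9.27)–(9.28) («p ∣ W_m»)] -/
def mstarProd (L : Fin k → ℤ × ℤ) (B N : ℕ) (m : Fin k) (M : ℕ) : ℕ :=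
  ∏ p ∈ N.primeFactors.filter (fun p => p.Coprime (wCut k B * B) ∧ ¬ p ∣ M ∧ ¬ p ∣ (L m).1.natAbs ∧
    m ∉ admIdx L p), p

/-- The modulus `W B r a_m W_m` of the `e_m`-summation (9.29): `a_m · WB · M · W_m` (`M = ∏ r`).
[cite: Maynard2016DenseClusters, proof of Lemma 9.3 p. 24, (9.27)–(9.29)] -/
def emModulus (L : Fin k → ℤ × ℤ) (B N : ℕ) (m : Fin k) (M : ℕ) : ℕ :=
  (L m).1.natAbs * (wCut k B * B) * M * mstarProd L B N m M

/-- A prime divides `W_m` iff it is one of its defining primes.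
[cite: Maynard2016DenseClusters, proof of Lemma 9.3 p. 24, (9.28)] -/
theorem prime_dvd_mstarProd_iff (L : Fin k → ℤ × ℤ) (B N : ℕ) (m : Fin k) (M : ℕ) {p : ℕ}
    (hp : p.Prime) :
    p ∣ mstarProd L B N m M ↔ p ∈ N.primeFactors ∧ (p.Coprime (wCut k B * B) ∧ ¬ p ∣ M ∧
      ¬ p ∣ (L m).1.natAbs ∧ m ∉ admIdx L p) := by
  unfold mstarProd
  rw [Prime.dvd_finsetProd_iff hp.prime]
  constructor
  · rintro ⟨q, hq, hpq⟩
    have hq' := Finset.mem_filter.1 hq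
    have hqp : q.Prime := Nat.prime_of_mem_primeFactors hq'.1
    rwa [(Nat.prime_dvd_prime_iff_eq hp hqp).1 hpq]
  · exact fun h => ⟨p, Finset.mem_filter.2 h, dvd_rfl⟩

/-- A prime divides `emModulus` iff it divides `a_m`, `WB`, `M` or `W_m`.
[cite: Maynard2016DenseClusters, proof of Lemma 9.3 p. 24, (9.27)–(9.29)] -/
theorem prime_dvd_emModulus_iff (L : Fin k → ℤ × ℤ) (B N : ℕ) (m : Fin k) (M : ℕ) {p : ℕ}
    (hp : p.Prime) :
    p ∣ emModulus L B N m M ↔ p ∣ (L m).1.natAbs ∨ p ∣ wCut k B * B ∨ p ∣ M ∨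
      p ∣ mstarProd L B N m M := by
  unfold emModulus
  rw [hp.dvd_mul, hp.dvd_mul, hp.dvd_mul, or_assoc, or_assoc]

/-- For a prime `p ∣ N`: `p ∤ emModulus ↔ good(p)` (`p ∤ WB`, `p ∤ M`, `p ∤ a_m`, `m ∈ admIdx(p)`).
[cite: Maynard2016DenseClusters, proof of Lemma 9.3 p. 24, (9.28) («p ∤ W B r a_m W_m»)] -/
theorem not_dvd_emModulus_iff {L : Fin k → ℤ × ℤ} {B N : ℕ} {m : Fin k} {M : ℕ} {p : ℕ}
    (hp : p ∈ N.primeFactors) :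
    ¬ p ∣ emModulus L B N m M ↔ p.Coprime (wCut k B * B) ∧ ¬ p ∣ M ∧ ¬ p ∣ (L m).1.natAbs ∧
      m ∈ admIdx L p := by
  classical
  have hpp : p.Prime := Nat.prime_of_mem_primeFactors hp
  rw [prime_dvd_emModulus_iff L B N m M hpp, prime_dvd_mstarProd_iff L B N m M hpp,
    Nat.Prime.coprime_iff_not_dvd hpp]
  constructor
  · intro h
    have ha : ¬ p ∣ (L m).1.natAbs := fun h' => h (Or.inl h')
    have hW : ¬ p ∣ wCut k B * B := fun h' => h (Or.inr (Or.inl h'))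
    have hM : ¬ p ∣ M := fun h' => h (Or.inr (Or.inr (Or.inl h')))
    refine ⟨hW, hM, ha, ?_⟩
    by_contra hm
    exact h (Or.inr (Or.inr (Or.inr ⟨hp, hW, hM, ha, hm⟩)))
  · rintro ⟨hW, hM, ha, hm⟩ (h | h | h | ⟨-, -, -, -, h⟩)
    · exact ha h
    · exact hW h
    · exact hM h
    · exact h hm

/-- The index set of `emEuler (emModulus … ⌊R⌋# …) ω (⌊R⌋+1)` is the set of good primes `≤ ⌊R⌋`.
[cite: Maynard2016DenseClusters, proof of Lemma 9.3 p. 24, (9.28)] -/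
theorem filter_primesBelow_not_dvd_emModulus (L : Fin k → ℤ × ℤ) (B : ℕ) (n : ℕ) (m : Fin k)
    (M : ℕ) :
    (Nat.primesBelow (n + 1)).filter (fun p => ¬ p ∣ emModulus L B (primorial n) m M) =
      (primorial n).primeFactors.filter (fun p => p.Coprime (wCut k B * B) ∧ ¬ p ∣ M ∧
        ¬ p ∣ (L m).1.natAbs ∧ m ∈ admIdx L p) := by
  rw [← primeFactors_primorial_eq_primesBelow]
  exact Finset.filter_congr fun p hp => not_dvd_emModulus_iff hp

/-- `emEuler (W B M a_m W_m) ω (⌊R⌋+1) = ∏_{p ≤ ⌊R⌋, good} X_p`.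
[cite: Maynard2016DenseClusters, proof of Lemma 9.3 p. 24, (9.28)] -/
theorem emEuler_emModulus_eq (L : Fin k → ℤ × ℤ) (B : ℕ) (n : ℕ) (m : Fin k) (M : ℕ) :
    MaynardDense.emEuler (emModulus L B (primorial n) m M) (omegaL L) (n + 1) =
      ∏ p ∈ (primorial n).primeFactors.filter (fun p => p.Coprime (wCut k B * B) ∧ ¬ p ∣ M ∧
        ¬ p ∣ (L m).1.natAbs ∧ m ∈ admIdx L p),
        ((p : ℝ) / ((p : ℝ) - 1) - 1 / ((p : ℝ) - omegaL L p)) := by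
  unfold MaynardDense.emEuler
  rw [filter_primesBelow_not_dvd_emModulus]

/-- The defining primes of `W_m` are primes. [cite: Maynard2016DenseClusters, proof of Lemma 9.3 p. 24, (9.28)] -/
theorem prime_of_mem_mstarSet {L : Fin k → ℤ × ℤ} {B N : ℕ} {m : Fin k} {M : ℕ} {p : ℕ}
    (hp : p ∈ N.primeFactors.filter (fun p => p.Coprime (wCut k B * B) ∧ ¬ p ∣ M ∧
      ¬ p ∣ (L m).1.natAbs ∧ m ∉ admIdx L p)) : p.Prime :=
  Nat.prime_of_mem_primeFactors (Finset.mem_filter.1 hp).1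

/-- **Display (9.28)**: `P' = ∏_{p ≤ ⌊R⌋} Λ_p(M) = emEuler (W B M a_m W_m) ω (⌊R⌋+1) · W_m/φ(W_m)`.
[cite: Maynard2016DenseClusters, proof of Lemma 9.3 p. 24, (9.27)–(9.28); FordGreenKonyaginMaynardTao2018, Thm 6 (7.13)] -/
theorem eulerProd_eq_emEuler_mul {L : Fin k → ℤ × ℤ} (hadm : FormsAdmissible L) (B : ℕ) (n : ℕ)
    (m : Fin k) (M : ℕ) :
    ∏ p ∈ (primorial n).primeFactors,
        eulerFactorM L B m M (fun p j => sPrimeM L m j p / ((p : ℝ) - omegaL L p)) p =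
      MaynardDense.emEuler (emModulus L B (primorial n) m M) (omegaL L) (n + 1) *
        ((mstarProd L B (primorial n) m M : ℕ) : ℝ) /
          (Nat.totient (mstarProd L B (primorial n) m M) : ℝ) := by
  rw [eulerProd_eq_prod_good_mul_prod_mstar hadm B m M _ fun p hp => Nat.prime_of_mem_primeFactors hp,
    emEuler_emModulus_eq, mul_div_assoc]
  congr 1
  unfold mstarProd
  rw [prod_div_sub_one_eq _ fun p hp => prime_of_mem_mstarSet hp, Nat.cast_prod]

/-- **The range of `c = e_m`** (display (9.27)): for `r ∈ 𝒟'^{(m)}_k`,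
`r[m↦c] ∈ admBox ↔ c ∣ ⌊R⌋# ∧ (c, a_m·WB·∏r·W_m) = 1`.
[cite: Maynard2016DenseClusters, proof of Lemma 9.3 pp. 23–24, (9.27) («e_m square-free, (e_m, W B r a_m) = 1, (e_m, W_m) = 1»)] -/
theorem update_mem_admBox_iff {L : Fin k → ℤ × ℤ} (hadm : FormsAdmissible L) {B : ℕ} {R : ℝ}
    {m : Fin k} {r : Fin k → ℕ} (hr : r ∈ dkBoxP L B R m) (c : ℕ) :
    Function.update r m c ∈ admBox L B R ↔
      c ∣ primorial ⌊R⌋₊ ∧ c.Coprime (emModulus L B (primorial ⌊R⌋₊) m (∏ i, r i)) := by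
  classical
  have hN : primorial ⌊R⌋₊ ≠ 0 := primorial_ne_zero _
  have hrm : r m = 1 := ((mem_dkBoxP_iff).1 hr).2.1
  constructor
  · intro hc
    have hcN : c ∣ primorial ⌊R⌋₊ := by
      have hc' := hc
      rw [admBox_eq] at hc'
      have h := ((mem_admBoxN_iff hN).1 hc').1 m
      rwa [Function.update_self] at h
    have hc0 : c ≠ 0 := fun h => hN (zero_dvd_iff.1 (h ▸ hcN))
    refine ⟨hcN, Nat.coprime_of_dvd fun p hp hpc hpM => ?_⟩
    have hpf : p ∈ c.primeFactors := Nat.mem_primeFactors.2 ⟨hp, hpc, hc0⟩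
    have hpN : p ∈ (primorial ⌊R⌋₊).primeFactors := Nat.mem_primeFactors.2 ⟨hp, hpc.trans hcN, hN⟩
    obtain ⟨hpW, hpr, hidx, hpa⟩ := prime_of_dvd_admissible_c hadm hr hc hpf
    exact (not_dvd_emModulus_iff hpN).2 ⟨hpW, hpr, hpa, hidx⟩ hpM
  · rintro ⟨hcN, hcop⟩
    have hc0 : c ≠ 0 := fun h => hN (zero_dvd_iff.1 (h ▸ hcN))
    have hsub : ∀ d, d ∣ emModulus L B (primorial ⌊R⌋₊) m (∏ i, r i) → c.Coprime d :=
      fun d hd => Nat.Coprime.coprime_dvd_right hd hcop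
    refine update_mem_admBox hr hcN
      (hsub _ ⟨(L m).1.natAbs * (wCut k B * B) * mstarProd L B (primorial ⌊R⌋₊) m (∏ i, r i),
        by unfold emModulus; ring⟩)
      (hsub _ ⟨(L m).1.natAbs * (∏ i, r i) * mstarProd L B (primorial ⌊R⌋₊) m (∏ i, r i),
        by unfold emModulus; ring⟩)
      fun p hp => ?_
    have hpp : p.Prime := Nat.prime_of_mem_primeFactors hp
    have hpc : p ∣ c := Nat.dvd_of_mem_primeFactors hp
    have hpN : p ∈ (primorial ⌊R⌋₊).primeFactors := Nat.mem_primeFactors.2 ⟨hpp, hpc.trans hcN, hN⟩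
    have hnot : ¬ p ∣ emModulus L B (primorial ⌊R⌋₊) m (∏ i, r i) := fun h =>
      (Nat.Prime.coprime_iff_not_dvd hpp).1 (Nat.Coprime.coprime_dvd_left hpc hcop) h
    exact mem_admIdx.1 ((not_dvd_emModulus_iff hpN).1 hnot).2.2.2

/-- On the range of `c`: `(∏_{p ∣ c}(p − ω(p))·X_p)⁻¹ = emWeight (emModulus) ω c`
(`(p − ω)X_p = emA`, `c` square-free and coprime to the modulus).
[cite: Maynard2016DenseClusters, proof of Lemma 9.3 p. 24, (9.28)–(9.29)] -/
theorem inv_prod_eq_emWeight {L : Fin k → ℤ × ℤ} (hadm : FormsAdmissible L) {B : ℕ} {R : ℝ}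
    {m : Fin k} {r : Fin k → ℕ} {c : ℕ} (hcN : c ∣ primorial ⌊R⌋₊)
    (hcop : c.Coprime (emModulus L B (primorial ⌊R⌋₊) m (∏ i, r i))) :
    (∏ p ∈ c.primeFactors, (((p : ℝ) - omegaL L p) *
        ((p : ℝ) / ((p : ℝ) - 1) - 1 / ((p : ℝ) - omegaL L p))))⁻¹ =
      MaynardDense.emWeight (emModulus L B (primorial ⌊R⌋₊) m (∏ i, r i)) (omegaL L) c := by
  have hsq : Squarefree c := (squarefree_primorial ⌊R⌋₊).squarefree_of_dvd hcN
  rw [MaynardDense.emWeight_of (omegaL L) ⟨hsq, hcop⟩]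
  congr 1
  refine Finset.prod_congr rfl fun p hp => ?_
  have hpp : p.Prime := Nat.prime_of_mem_primeFactors hp
  have hωlt : omegaL L p < p := ((formsAdmissible_iff_omegaL L).1 hadm).2 p hpp
  have hpω : ((p : ℝ) - omegaL L p) ≠ 0 := by
    have : (omegaL L p : ℝ) < p := by exact_mod_cast hωlt
    linarith
  rw [sub_mul_emFactor_eq hpω]
  rfl

end FGKMT2018

end Literature.NumberTheory.Sieve
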